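import Summits.ResolutionOfSingularities.ResolutionOfSingularities.Theorems.ValuativeLuAlphaPTorsorDimTwoTransport
import Literature.AlgebraicGeometry.Resolution.QuadraticTransformsProofs

/-!
# Base dimension two of `LuAlphaPTorsor`: monomialization with model bookkeeping (stub B2)

Crux `Valuative.LuAlphaPTorsor` (item `stmt-ResolutionOfSingularities-0641`), line
`pfaff-line-log-final-forms`, stub `stub_dimTwoMonomialization`: the base-dimension-two model
bookkeeping of the line. Given the monomialization of one element along the quadratic sequence
of a two-dimensional regular local ring (the line's stub B1, taken as a hypothesis), a finitely
generated base `A₀ ⊆ O` regular of dimension two at the centre of the valuation ring `O`, a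
finite set `F ⊆ O ∩ Frac A₀` and `0 ≠ b ∈ F`, it produces a finitely generated model
`A₀ ∪ F ⊆ A₁ ⊆ O ∩ Frac A₀`, regular at the centre, in whose local ring `b` is a monomial in a
regular system of parameters (elements of `A₁`) times a unit `w` with `w, w⁻¹ ∈ A₁`, stated as
an identity in `K`. Ingredients: the plumbing of `…DimTwoTransport.lean` (the local ring of the
base inside the subfield `Frac A₀`, its quadratic sequence, the Japanese hypothesis) and
Abhyankar's union lemma `AbhyankarQuadraticUnion_holds` (Abhyankar 1956, Lemma 12, PROVED in
the tree).
-/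

set_option linter.dupNamespace false

namespace Summit.ResolutionOfSingularities.ResolutionOfSingularities.Theorems.PfaffLine

open IsLocalRing Literature.AlgebraicGeometry.Resolution

/-- **Stub B2 of the line `pfaff-line-log-final-forms`: dimension-two monomialization with
model bookkeeping** (characteristic free). For a finitely generated `A₀ ⊆ O`, regular of
dimension two at the centre of `O`, a finite `F ⊆ O ∩ Frac A₀` and a non-zero `b ∈ F`, there is
a finitely generated model `A₁` with `A₀ ∪ F ⊆ A₁ ⊆ O ∩ Frac A₀`, regular at the centre, in
whose local ring at the centre `b` is a monomial in a regular system of parameters `x_i ∈ A₁`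
times a unit `w` with `w, w⁻¹ ∈ A₁` — GIVEN, as the first hypothesis, the monomialization of one
element along the quadratic sequence of a two-dimensional regular local ring (stub B1,
`stub_curveMonomialization`). Proof: realise `K₀ = Frac A₀ = Subfield.closure A₀` as the field
`↥K₀` with its embedding `ι` into `K`; the local ring `R₀` of the pulled-back base at the centre
of `O' = O.comap ι` is a two-dimensional regular local ring of `↥K₀` dominated by `O'` and
Japanese in dimension one (`base_locAtCentre_comap`); its quadratic sequence `R` along `O'`
exists (`isQuadraticTransformAlong_quadraticSeq_of_ringKrullDim_eq_two`); by Abhyankar's union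
lemma (`AbhyankarQuadraticUnion_holds`) `F ⊆ R i₀` for some `i₀`; stub B1 monomializes `b` in
some `R i`, `i ≥ i₀`; finally `R i = (A₀'[G])_{𝔪 ∩ A₀'[G]}` for a finite `G ⊆ R i` containing
`F`, the parameters and `w^{±1}` (towers of local blowing ups are one local blowing up, plus the
sandwich property of `locAtCentre`), and `A₁ = A₀[ι G]` is the model. [folklore] -/
theorem stub_dimTwoMonomialization :
    (∀ (K' : Type) [Field K'] (O' : ValuationSubring K') (R : ℕ → Subring K'), IsRegularLocalRing (R 0) → ringKrullDim (R 0) = 2 → Literature.AlgebraicGeometry.Resolution.IsLocalRingOf (R 0) → Literature.AlgebraicGeometry.Resolution.SubringDominates (R 0) O'.toSubring → (∀ i, Literature.AlgebraicGeometry.Resolution.IsQuadraticTransformAlong O' (R i) (R (i + 1))) → (∀ (𝔮 : Ideal (R 0)) (L : Type) [Field L] [Algebra (R 0 ⧸ 𝔮) L] [IsFractionRing (R 0 ⧸ 𝔮) L], 𝔮.IsPrime → ringKrullDim (R 0 ⧸ 𝔮) = 1 → Module.Finite (R 0 ⧸ 𝔮) (integralClosure (R 0 ⧸ 𝔮) L))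 → ∀ (i₀ : ℕ) (b : K'), b ∈ R i₀ → b ≠ 0 → ∃ i : ℕ, i₀ ≤ i ∧ ∃ (d : ℕ) (u : Fin d → R i) (M : Fin d → ℕ) (w : R i), IsUnit w ∧ (∀ z : R i, z ∈ Ideal.span (Set.range u) ↔ ¬ IsUnit z) ∧ ringKrullDim (R i) = (d : WithBot ℕ∞) ∧ b = (Finset.univ.prod fun j => ((u j : R i) : K') ^ M j) * ((w : R i) : K')) → ∀ (k K : Type) [Field k] [Field K] [Algebra k K] (O : ValuationSubring K) (A₀ : Subalgebra k K) (h₀ : A₀.toSubring ≤ O.toSubring), A₀.FG → IsRegularLocalRing (Localization.AtPrime (Ideal.comap (Subring.inclusion h₀) (IsLocalRing.maximalIdeal O))) → ringKrullDim (Localization.AtPrime (Ideal.comap (Subring.inclusion h₀) (IsLocalRing.maximalIdeal O))) = 2 → ∀ (F : Finset K), (∀ z ∈ F, z ∈ O ∧ z ∈ Subfield.closure (A₀ : Set K)) → ∀ b ∈ F, b ≠ 0 → ∃ (A₁ : Subalgebra k K) (h₁ : A₁.toSubring ≤ O.toSubring), A₀ ≤ A₁ ∧ A₁.FG ∧ (↑F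 ⊆ (A₁ : Set K)) ∧ ((A₁ : Set K) ⊆ Subfield.closure (A₀ : Set K)) ∧ IsRegularLocalRing (Localization.AtPrime (Ideal.comap (Subring.inclusion h₁) (IsLocalRing.maximalIdeal O))) ∧ ∃ (d : ℕ) (x : Fin d → K) (hx : ∀ i, x i ∈ A₁) (M : Fin d → ℕ) (w : K), w ∈ A₁ ∧ w⁻¹ ∈ A₁ ∧ Ideal.span (Set.range fun i => algebraMap A₁.toSubring (Localization.AtPrime (Ideal.comap (Subring.inclusion h₁) (IsLocalRing.maximalIdeal O))) ⟨x i, hx i⟩) = IsLocalRing.maximalIdeal (Localization.AtPrime (Ideal.comap (Subring.inclusion h₁) (IsLocalRing.maximalIdeal O))) ∧ ringKrullDim (Localization.AtPrime (Ideal.comap (Subring.inclusion h₁) (IsLocalRing.maximalIdeal O))) = (d : WithBot ℕ∞) ∧ b = (Finset.univ.prod fun i => x i ^ M i) * w := by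
  intro hB1 k K _ _ _ O A₀ h₀ hfg hreg hdim F hF b hbF hb0
  classical
  -- (1) the subfield `K₀ = Frac A₀` of `K`, and the pulled-back valuation ring and base model
  set K₀ : Subfield K := Subfield.closure (A₀ : Set K)
  set ι : K₀ →+* K := K₀.subtype
  have hιrange : ∀ x : K, x ∈ ι.range ↔ x ∈ K₀ := fun x =>
    ⟨fun ⟨y, hy⟩ => hy ▸ y.2, fun hx => ⟨⟨x, hx⟩, rfl⟩⟩
  have hA₀range : A₀.toSubring ≤ ι.range := fun x hx =>
    (hιrange x).mpr (Subfield.subset_closure hx)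
  have hclos : Subring.closure (A₀ : Set K) = A₀.toSubring := by
    rw [← Subalgebra.coe_toSubring, Subring.closure_eq]
  have hfrac : ∀ z : K₀, ∃ a ∈ A₀.toSubring, ∃ c ∈ A₀.toSubring, ι z = a / c := by
    intro z
    obtain ⟨y, hy, w, hw, hz⟩ := Subfield.mem_closure_iff.mp z.2
    rw [hclos] at hy hw
    exact ⟨y, hy, w, hw, hz.symm⟩
  set O' : ValuationSubring K₀ := O.comap ι
  set A₀' : Subring K₀ := A₀.toSubring.comap ι
  have h₀' : A₀' ≤ O'.toSubring := comap_le_comap_valuationSubring ι h₀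
  -- (2) the base ring `R₀` inside `K₀`
  set R₀ : Subring K₀ := locAtCentre A₀' O'
  obtain ⟨hreg₀, hdim₀, hof₀, hdom₀, hjap⟩ :=
    base_locAtCentre_comap ι O A₀ h₀ hfg hreg hdim hA₀range hfrac
  -- (3) the quadratic sequence along `O'`
  have hstep := isQuadraticTransformAlong_quadraticSeq_of_ringKrullDim_eq_two hreg₀ hdim₀ hdom₀
  set R : ℕ → Subring K₀ := quadraticSeq O' R₀
  have hR0 : R 0 = R₀ := rfl
  have hmono : Monotone R := sequence_monotone hstep
  -- (4)/(5) Abhyankar's union lemma absorbs `F`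
  have hunion := AbhyankarQuadraticUnion_holds K₀ O' R hreg₀ hdim₀ hof₀ hdom₀ hstep
  have hFK₀ : ∀ z ∈ F, z ∈ K₀ := fun z hz => (hF z hz).2
  have hFi : ∀ z : F, ∃ i, (⟨z.1, hFK₀ z.1 z.2⟩ : K₀) ∈ R i := fun z =>
    (hunion ⟨z.1, hFK₀ z.1 z.2⟩).mp (ValuationSubring.mem_comap.mpr (hF z.1 z.2).1)
  choose idx hidx using hFi
  set i₀ : ℕ := F.attach.sup idx
  have hFi₀ : ∀ (z) (hz : z ∈ F), (⟨z, hFK₀ z hz⟩ : K₀) ∈ R i₀ := fun z hz =>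
    hmono (Finset.le_sup (f := idx) (Finset.mem_attach F ⟨z, hz⟩)) (hidx ⟨z, hz⟩)
  have hb0' : (⟨b, hFK₀ b hbF⟩ : K₀) ≠ 0 := fun h => hb0 (congrArg Subtype.val h)
  -- apply stub B1
  obtain ⟨i, hi₀i, d, u, M, w, hw, hspan, hdimi, hbeq⟩ :=
    hB1 K₀ O' R hreg₀ hdim₀ hof₀ hdom₀ hstep hjap i₀ ⟨b, hFK₀ b hbF⟩ (hFi₀ b hbF) hb0'
  -- (6) model bookkeeping: `R i = (A₀'[G])_{𝔪 ∩ A₀'[G]}` for a finite `G ⊆ R i`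
  have hregi : IsRegularLocalRing (R i) := isRegularLocalRing_sequence hreg₀ hstep i
  have hRiO : R i ≤ O'.toSubring := (sequence_dominates hdom₀ hstep i).1.1
  obtain ⟨t, htO, hRit⟩ := exists_eq_locAtCentre_closure_of_sequence h₀' hR0 hstep i
  have hwinv : ((w : R i) : K₀)⁻¹ ∈ R i := ((isUnit_subring_iff_inv_mem w).mp hw).2
  set F' : Finset K₀ := F.attach.image fun z => (⟨z.1, hFK₀ z.1 z.2⟩ : K₀) with hF'
  set G : Finset K₀ := t ∪ F' ∪ Finset.univ.image (fun j => ((u j : R i) : K₀)) ∪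
    {((w : R i) : K₀), ((w : R i) : K₀)⁻¹} with hG
  have htG : t ⊆ G := fun x hx => by simp [hG, hx]
  have hF'G : ∀ (z) (hz : z ∈ F), (⟨z, hFK₀ z hz⟩ : K₀) ∈ G := fun z hz => by
    have : (⟨z, hFK₀ z hz⟩ : K₀) ∈ F' := Finset.mem_image.mpr ⟨⟨z, hz⟩, Finset.mem_attach _ _, rfl⟩
    simp [hG, this]
  have huG : ∀ j, ((u j : R i) : K₀) ∈ G := fun j => by simp [hG]
  have hwG : ((w : R i) : K₀) ∈ G := by simp [hG]
  have hwG' : ((w : R i) : K₀)⁻¹ ∈ G := by simp [hG]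
  have hGR : (↑G : Set K₀) ⊆ R i := by
    intro x hx
    simp only [hG, Finset.coe_union, Finset.coe_insert, Finset.coe_singleton, Finset.coe_image,
      Set.mem_union, Set.mem_insert_iff, Set.mem_singleton_iff, Set.mem_image, Finset.mem_coe,
      Finset.coe_univ, Set.mem_univ, true_and] at hx
    rcases hx with ((hx | hx) | ⟨j, rfl⟩) | (rfl | rfl)
    · rw [hRit]
      exact le_locAtCentre _ O' (Subring.subset_closure (Or.inr hx))
    · rw [hF'] at hx
      obtain ⟨z, -, rfl⟩ := Finset.mem_image.mp hx
      exact hmono hi₀i (hFi₀ z.1 z.2)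
    · exact (u j).2
    · exact w.2
    · exact hwinv
  set B₁ : Subring K₀ := Subring.closure ((A₀' : Set K₀) ∪ ↑G) with hB₁
  have hB₁Ri : B₁ ≤ R i := by
    refine Subring.closure_le.mpr (Set.union_subset (fun x hx => ?_) hGR)
    rw [hRit]
    exact le_locAtCentre _ O' (Subring.subset_closure (Or.inl hx))
  have hB₁loc : locAtCentre B₁ O' = R i := by
    rw [hRit]
    refine locAtCentre_eq_of_le_of_le O' (Subring.closure_mono ?_) (hRit ▸ hB₁Ri)
    exact Set.union_subset_union_right _ (by exact_mod_cast htG)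
  -- the model `A₁ = A₀[ι G]` in `K`
  set A₁ : Subalgebra k K := Algebra.adjoin k ((A₀ : Set K) ∪ ι '' ↑G) with hA₁
  have hA₁sub : A₁.toSubring = B₁.map ι := by
    rw [hA₁, Algebra.adjoin_eq_ring_closure, hB₁, RingHom.map_closure, Set.image_union,
      ← Subring.coe_map, Subring.map_comap_eq_self hA₀range, Subalgebra.coe_toSubring]
    congr 1
    refine Set.union_eq_right.mpr fun x hx => ?_
    obtain ⟨c, rfl⟩ := hx
    exact Or.inl (A₀.algebraMap_mem c)
  have hA₁comap : A₁.toSubring.comap ι = B₁ := by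
    rw [hA₁sub, Subring.comap_map_eq_self_of_injective ι.injective]
  have hA₁range : A₁.toSubring ≤ ι.range := by
    rw [hA₁sub]; rintro _ ⟨y, -, rfl⟩; exact ⟨y, rfl⟩
  have h₁ : A₁.toSubring ≤ O.toSubring := by
    rw [hA₁sub]; rintro _ ⟨y, hy, rfl⟩
    exact hRiO (hB₁Ri hy)
  have hRi' : (locAtCentre A₁.toSubring O).comap ι = R i := by
    rw [comap_locAtCentre ι O hA₁range, hA₁comap, hB₁loc]
  obtain ⟨e, he⟩ := exists_ringEquiv_atPrime ι O A₁.toSubring h₁ hA₁range hRi'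
  have hgen : ∀ y ∈ G, ι y ∈ A₁ := fun y hy =>
    Algebra.subset_adjoin (Or.inr ⟨y, Finset.mem_coe.mpr hy, rfl⟩)
  have hx : ∀ j, ι ((u j : R i) : K₀) ∈ A₁ := fun j => hgen _ (huG j)
  haveI := hregi
  refine ⟨A₁, h₁, fun x hx => Algebra.subset_adjoin (Or.inl hx), ?_, ?_, ?_,
    IsRegularLocalRing.of_ringEquiv e, d, fun j => ι ((u j : R i) : K₀), hx, M,
    ι ((w : R i) : K₀), hgen _ hwG, ?_, ?_, ?_, ?_⟩
  · -- finite generation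
    rw [hA₁, Algebra.adjoin_union, Algebra.adjoin_eq, ← Finset.coe_image]
    exact hfg.sup (Subalgebra.fg_adjoin_finset _)
  · -- `F ⊆ A₁`
    intro z hz
    exact hgen _ (hF'G z hz)
  · -- `A₁ ⊆ K₀`
    intro x hxA
    have hx' : x ∈ A₁.toSubring := hxA
    rw [hA₁sub] at hx'
    obtain ⟨y, -, rfl⟩ := hx'
    exact y.2
  · -- `w⁻¹ ∈ A₁`
    rw [← map_inv₀]
    exact hgen _ hwG'
  · -- the regular system of parameters
    have hspan' : Ideal.span (Set.range u) = maximalIdeal (R i) := by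
      ext z
      rw [hspan z, mem_maximalIdeal, mem_nonunits_iff]
    have hfun : (fun j => algebraMap A₁.toSubring
        (Localization.AtPrime (Ideal.comap (Subring.inclusion h₁) (maximalIdeal O)))
          ⟨ι ((u j : R i) : K₀), hx j⟩) = e ∘ u := funext fun j => (he (u j) (hx j)).symm
    rw [hfun, Set.range_comp, ← Ideal.map_span, hspan', map_ringEquiv_maximalIdeal]
  · -- dimension
    rw [← hdimi]
    exact (ringKrullDim_eq_of_ringEquiv e).symm
  · -- the monomial identity in `K`
    have := congrArg ι hbeq
    rw [map_mul, map_prod] at this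
    simp_rw [map_pow] at this
    exact this

end Summit.ResolutionOfSingularities.ResolutionOfSingularities.Theorems.PfaffLine
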